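import Literature.NumberTheory.QuadraticForms.TransferForm
import Literature.NumberTheory.QuadraticForms.TransferFormDiagonal
import Mathlib.RingTheory.Trace.Basic
import Mathlib.LinearAlgebra.Matrix.Trace
import HarnessLib

/-!
# Transfer blocks `T⟨α⟩` over a quadratic étale algebra `E = ℚ ⊕ ℚθ`, `θ² = d`

Topic `Literature/NumberTheory/QuadraticForms`; namespace `Literature.NumberTheory.QuadraticForms`.
Everything here is proved; it is the `E`-side tool-kit for the discharge of Cor. 11.4 of
Bayer-Fluckiger–van Geemen–Schütt (`BFvGS2025_transfer_realQuadratic_of_det_neg_one`,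
`TransferForm.lean`), in `TransferFormProofs.lean`.

Throughout, `E` is a commutative `ℚ`-algebra with an element `θ`, a rational `d` with `θ² = d`,
and a `ℚ`-basis `b = (1, θ)` (so `E ≅ ℚ[X]/(X² - d)`; for `d` a non-square, a quadratic field).
Elements are written `u + vθ` (`algebraMap ℚ E u + algebraMap ℚ E v * θ`). We record:

* coordinates, products `(u + vθ)(p + qθ) = (up + dvq) + (uq + vp)θ`, `Tr_{E/ℚ}(u + vθ) = 2u`
  (trace of the regular representation in the basis `b`);
* the **transfer block** `T⟨α⟩ := transfer E (α • sq)`, `ξ ↦ Tr(α ξ²)`, evaluated in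
  coordinates: `T⟨u + vθ⟩(p + qθ) = 2(u p² + 2 d v p q + d u q²)` (Bayer-Fluckiger–van
  Geemen–Schütt 2025, Def. 3.2 and Example 3.3/3.5: `T⟨α⟩` is the binary rational form of
  determinant `4 d N(α)`);
* `equivalent_pair_transfer_smul_sq` — **a rational binary form `⟨t, x⟩` with
  `x ∈ t · d · N(E^×) · ℚ^{×2}` is a transfer block**: for `x = t d (g² - d h²) r²`, `g ≠ 0`,
  `⟨t, x⟩ ≅ T⟨β⟩` with `β = (t/2)(1 + (h/g) θ)` (`Tr β = t`, `N β = (t/2g)² (g² - d h²)`);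
* `equivalent_transfer_conj` — conjugation is an isometry of blocks:
  `T⟨u + vθ⟩ ≅ T⟨u - vθ⟩`; and the conjugation ring endomorphism `u + vθ ↦ u - vθ`
  (`exists_conjRingHom`);
* `transfer_weightedSumSquares_eq_pi` — `T(⟨α₁, …, α_m⟩) = ⊥ᵢ T⟨αᵢ⟩`; `Equivalent.transfer` —
  `E`-isometric forms have isometric transfers.

## References

* [BayerFluckigerVanGeemenSchuett2025] E. Bayer-Fluckiger, B. van Geemen, M. Schütt,
  *Non-projective K3 surfaces with real or Salem multiplication*, arXiv:2511.19970, §3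
  (Def. 3.2, Ex. 3.3, Lemma 3.4, Ex. 3.5) and §9 (Ex. 9.2).
-/

namespace Literature.NumberTheory.QuadraticForms

open QuadraticMap Module

/-! ### Functoriality of the transfer -/

section Functorial

variable (E : Type*) [Field E] [Algebra ℚ E]

/-- `E`-isometric quadratic forms have `ℚ`-isometric transfers (restrict the scalars of the
isometry). [cite: BayerFluckigerVanGeemenSchuett2025, Def. 3.2] -/
theorem Equivalent.transfer {W W' : Type*} [AddCommGroup W] [Module E W] [Module ℚ W]
    [IsScalarTower ℚ E W] [AddCommGroup W'] [Module E W'] [Module ℚ W'] [IsScalarTower ℚ E W']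
    {Q : QuadraticForm E W} {Q' : QuadraticForm E W'} (h : Q.Equivalent Q') :
    (transfer E Q).Equivalent (transfer E Q') := by
  obtain ⟨e⟩ := h
  exact ⟨{ (e.toLinearEquiv.restrictScalars ℚ : W ≃ₗ[ℚ] W') with
    map_app' := fun x => by
      change Algebra.trace ℚ E (Q' (e x)) = Algebra.trace ℚ E (Q x)
      rw [e.map_app] }⟩

/-- The transfer of a diagonal form is the orthogonal sum of the transfer blocks of its
weights: `T_E(⟨α₁, …, α_m⟩) = ⊥ᵢ T⟨αᵢ⟩` with `T⟨α⟩ = transfer E (α • sq) : ξ ↦ Tr(α ξ²)`.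
[cite: BayerFluckigerVanGeemenSchuett2025, Def. 3.2] -/
theorem transfer_weightedSumSquares_eq_pi {ι : Type*} [Fintype ι] (α : ι → E) :
    transfer E (weightedSumSquares E α) =
      QuadraticMap.pi fun i => transfer E (α i • (QuadraticMap.sq (R := E))) := by
  ext v
  simp only [transfer_apply, weightedSumSquares_apply, map_sum, pi_apply, QuadraticMap.smul_apply,
    QuadraticMap.sq_apply]

/-- `T⟨α⟩(ξ) = Tr_{E/ℚ}(α ξ²)`. [cite: BayerFluckigerVanGeemenSchuett2025, Def. 3.2] -/
theorem transfer_smul_sq_apply (α ξ : E) :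
    transfer E (α • (QuadraticMap.sq (R := E))) ξ = Algebra.trace ℚ E (α * (ξ * ξ)) := by
  simp only [transfer_apply, QuadraticMap.smul_apply, QuadraticMap.sq_apply, smul_eq_mul]

end Functorial

/-! ### Coordinates in `E = ℚ ⊕ ℚ θ`, `θ² = d` -/

section Coordinates

variable {E : Type*} [Field E] [Algebra ℚ E] {θ : E} {d : ℚ}
  (hθ : θ * θ = algebraMap ℚ E d) (b : Basis (Fin 2) ℚ E) (hb0 : b 0 = 1) (hb1 : b 1 = θ)

include hb0 hb1 in
/-- `b.equivFun.symm (p, q) = p + qθ`. [folklore] -/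
theorem basis_equivFun_symm_apply (w : Fin 2 → ℚ) :
    b.equivFun.symm w = algebraMap ℚ E (w 0) + algebraMap ℚ E (w 1) * θ := by
  rw [Basis.equivFun_symm_apply, Fin.sum_univ_two, hb0, hb1, Algebra.smul_def, Algebra.smul_def,
    mul_one]

include hb0 hb1 in
/-- Every element is `u + vθ` with `(u, v)` its coordinates. [folklore] -/
theorem eq_coord_add_coord_mul (ξ : E) :
    ξ = algebraMap ℚ E (b.repr ξ 0) + algebraMap ℚ E (b.repr ξ 1) * θ := by
  conv_lhs => rw [← b.sum_repr ξ]
  rw [Fin.sum_univ_two, hb0, hb1, Algebra.smul_def, Algebra.smul_def, mul_one]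

include hb0 hb1 in
/-- The coordinates of `u + vθ` are `(u, v)`. [folklore] -/
theorem repr_coord (u v : ℚ) :
    b.repr (algebraMap ℚ E u + algebraMap ℚ E v * θ) 0 = u ∧
      b.repr (algebraMap ℚ E u + algebraMap ℚ E v * θ) 1 = v := by
  have h : algebraMap ℚ E u + algebraMap ℚ E v * θ = u • b 0 + v • b 1 := by
    rw [hb0, hb1, Algebra.smul_def, Algebra.smul_def, mul_one]
  rw [h, map_add, map_smul, map_smul, b.repr_self, b.repr_self]
  simp

include hθ in
/-- Multiplication in coordinates: `(u + vθ)(p + qθ) = (up + dvq) + (uq + vp)θ`. [folklore] -/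
theorem coord_mul_coord (u v p q : ℚ) :
    (algebraMap ℚ E u + algebraMap ℚ E v * θ) * (algebraMap ℚ E p + algebraMap ℚ E q * θ) =
      algebraMap ℚ E (u * p + d * v * q) + algebraMap ℚ E (u * q + v * p) * θ := by
  simp only [map_add, map_mul]
  linear_combination (algebraMap ℚ E v * algebraMap ℚ E q) * hθ

include hb0 hb1 in
/-- `[E : ℚ] = 2`. [folklore] -/
theorem finrank_eq_two_of_basis : finrank ℚ E = 2 := by
  have := hb0; have := hb1
  simpa using finrank_eq_card_basis b

include hθ hb0 hb1 in
/-- `Tr_{E/ℚ}(θ) = 0`: the matrix of multiplication by `θ` in the basis `(1, θ)` is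
`(0 d; 1 0)`. [folklore] -/
theorem trace_theta : Algebra.trace ℚ E θ = 0 := by
  classical
  rw [Algebra.trace_eq_matrix_trace b, Matrix.trace_fin_two, Algebra.leftMulMatrix_eq_repr_mul,
    Algebra.leftMulMatrix_eq_repr_mul, hb0, hb1, mul_one, hθ]
  have h1 : b.repr θ 0 = 0 := by
    rw [← hb1, b.repr_self]; simp
  have h2 : b.repr (algebraMap ℚ E d) 1 = 0 := by
    have : algebraMap ℚ E d = d • b 0 := by rw [hb0, Algebra.algebraMap_eq_smul_one]
    rw [this, map_smul, b.repr_self]; simp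
  rw [h1, h2, add_zero]

include hθ hb0 hb1 in
/-- `Tr_{E/ℚ}(u + vθ) = 2u`. [folklore] -/
theorem trace_coord (u v : ℚ) :
    Algebra.trace ℚ E (algebraMap ℚ E u + algebraMap ℚ E v * θ) = 2 * u := by
  rw [map_add, Algebra.trace_algebraMap, finrank_eq_two_of_basis b hb0 hb1,
    ← Algebra.smul_def, map_smul, trace_theta hθ b hb0 hb1, smul_zero, add_zero, nsmul_eq_mul,
    Nat.cast_ofNat]

include hθ hb0 hb1 in
/-- **The transfer block in coordinates**: `T⟨u + vθ⟩(p + qθ) = 2(u p² + 2 d v p q + d u q²)`,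
the binary rational form `(2u, 4dv; ·, 2du)` of determinant `4d(u² - dv²) = 4 d N(u + vθ)`
(Bayer-Fluckiger–van Geemen–Schütt, Ex. 3.5: `det T⟨α⟩ = Δ_E N(α) = d N(α)`).
[cite: BayerFluckigerVanGeemenSchuett2025, Ex. 3.5] -/
theorem transfer_smul_sq_coord (u v p q : ℚ) :
    transfer E ((algebraMap ℚ E u + algebraMap ℚ E v * θ) • (QuadraticMap.sq (R := E)))
        (algebraMap ℚ E p + algebraMap ℚ E q * θ) =
      2 * (u * p ^ 2 + 2 * d * v * p * q + d * u * q ^ 2) := by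
  rw [transfer_smul_sq_apply, coord_mul_coord hθ, coord_mul_coord hθ, trace_coord hθ b hb0 hb1]
  ring

include hθ hb0 hb1 in
/-- **A rational binary form `⟨t, x⟩` with `x ∈ t · d · N(E^×) ℚ^{×2}` is a transfer block.**
If `x = t d (g² - d h²) r²` with `t, g, r ≠ 0`, then `⟨t, x⟩ ≅ T⟨β⟩` for
`β = t/2 + (t h / 2g) θ` — the block represents `Tr(β) = t` at `ξ = 1`, and its determinant
class is `d N(β) = d (t/2g)² (g² - dh²) ≡ t x`; explicitly the vectors `1` and
`(2gr/t)(-d·(th/2g) + (t/2) θ)` are an orthogonal basis with values `t`, `x`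
(Bayer-Fluckiger–van Geemen–Schütt, Ex. 3.3 is the case `⟨1, 1⟩ ≅ T⟨(d + u√d)/2d⟩`).
[cite: BayerFluckigerVanGeemenSchuett2025, Ex. 3.3] -/
theorem equivalent_pair_transfer_smul_sq {t x g h r : ℚ} (ht : t ≠ 0) (hg : g ≠ 0) (hr : r ≠ 0)
    (hx : x = t * d * (g ^ 2 - d * h ^ 2) * r ^ 2) :
    Equivalent (weightedSumSquares ℚ ![t, x])
      (transfer E ((algebraMap ℚ E (t / 2) + algebraMap ℚ E (t * h / (2 * g)) * θ) •
        (QuadraticMap.sq (R := E)))) := by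
  -- the change of coordinates `(p, q) ↦ (p - q c d v, q c u)`, `u = t/2`, `v = th/2g`, `c = 2gr/t`
  set u : ℚ := t / 2 with hu
  set v : ℚ := t * h / (2 * g) with hv
  set c : ℚ := 2 * g * r / t with hc
  have hu0 : u ≠ 0 := by rw [hu]; exact div_ne_zero ht two_ne_zero
  have hc0 : c ≠ 0 := by
    rw [hc]; exact div_ne_zero (mul_ne_zero (mul_ne_zero two_ne_zero hg) hr) ht
  let M : (Fin 2 → ℚ) ≃ₗ[ℚ] (Fin 2 → ℚ) :=
    { toFun := fun w => ![w 0 - w 1 * (c * d * v), w 1 * (c * u)]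
      invFun := fun w => ![w 0 + w 1 * (d * v / u), w 1 / (c * u)]
      map_add' := fun w w' => by
        ext i; fin_cases i
        · simp; ring
        · simp; ring
      map_smul' := fun a w => by
        ext i; fin_cases i
        · simp; ring
        · simp; ring
      left_inv := fun w => by
        ext i; fin_cases i
        · simp; field_simp; ring
        · simp; field_simp
      right_inv := fun w => by
        ext i; fin_cases i
        · simp; field_simp; ring
        · simp; field_simp }
  let f : (Fin 2 → ℚ) ≃ₗ[ℚ] E := M.trans b.equivFun.symm
  have key : weightedSumSquares ℚ ![t, x] =
      (transfer E ((algebraMap ℚ E u + algebraMap ℚ E v * θ) • (QuadraticMap.sq (R := E)))).comp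
        (f : (Fin 2 → ℚ) →ₗ[ℚ] E) := by
    ext w
    rw [QuadraticMap.comp_apply, LinearEquiv.coe_coe, LinearEquiv.trans_apply,
      basis_equivFun_symm_apply b hb0 hb1, transfer_smul_sq_coord hθ b hb0 hb1,
      weightedSumSquares_apply, Fin.sum_univ_two]
    simp only [M, LinearEquiv.coe_mk, LinearMap.coe_mk, AddHom.coe_mk, Matrix.cons_val_zero,
      Matrix.cons_val_one, smul_eq_mul, hx, hu, hv, hc]
    field_simp
    ring
  rw [key]
  exact equivalent_comp_linearEquiv _ _

include hθ hb0 hb1 in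
/-- **Conjugate blocks are isometric**: `T⟨u + vθ⟩ ≅ T⟨u - vθ⟩`, by the `ℚ`-linear conjugation
`p + qθ ↦ p - qθ` of `E` (`Tr` is conjugation invariant).
[cite: BayerFluckigerVanGeemenSchuett2025, Def. 3.2] -/
theorem equivalent_transfer_conj (u v : ℚ) :
    Equivalent
      (transfer E ((algebraMap ℚ E u + algebraMap ℚ E v * θ) • (QuadraticMap.sq (R := E))))
      (transfer E ((algebraMap ℚ E u + algebraMap ℚ E (-v) * θ) • (QuadraticMap.sq (R := E)))) := by
  let N : (Fin 2 → ℚ) ≃ₗ[ℚ] (Fin 2 → ℚ) :=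
    { toFun := fun w => ![w 0, -w 1]
      invFun := fun w => ![w 0, -w 1]
      map_add' := fun w w' => by
        ext i; fin_cases i
        · simp
        · simp; ring
      map_smul' := fun a w => by ext i; fin_cases i <;> simp
      left_inv := fun w => by ext i; fin_cases i <;> simp
      right_inv := fun w => by ext i; fin_cases i <;> simp }
  let f : E ≃ₗ[ℚ] E := (b.equivFun.trans N).trans b.equivFun.symm
  have key : transfer E ((algebraMap ℚ E u + algebraMap ℚ E v * θ) • (QuadraticMap.sq (R := E))) =
      (transfer E ((algebraMap ℚ E u + algebraMap ℚ E (-v) * θ) •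
        (QuadraticMap.sq (R := E)))).comp (f : E →ₗ[ℚ] E) := by
    ext ξ
    rw [QuadraticMap.comp_apply, LinearEquiv.coe_coe, LinearEquiv.trans_apply,
      LinearEquiv.trans_apply, basis_equivFun_symm_apply b hb0 hb1,
      transfer_smul_sq_coord hθ b hb0 hb1]
    conv_lhs => rw [eq_coord_add_coord_mul b hb0 hb1 ξ, transfer_smul_sq_coord hθ b hb0 hb1]
    simp only [N, LinearEquiv.coe_mk, LinearMap.coe_mk, AddHom.coe_mk, Matrix.cons_val_zero,
      Matrix.cons_val_one, Basis.equivFun_apply]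
    ring
  rw [key]
  exact equivalent_comp_linearEquiv _ _

include hθ hb0 hb1 in
/-- **The conjugation** `u + vθ ↦ u - vθ` is a ring endomorphism of `E` (the non-trivial
`ℚ`-automorphism of the quadratic algebra `ℚ[θ]`). [folklore] -/
theorem exists_conjRingHom :
    ∃ τ : E →+* E, ∀ u v : ℚ,
      τ (algebraMap ℚ E u + algebraMap ℚ E v * θ) = algebraMap ℚ E u + algebraMap ℚ E (-v) * θ := by
  have hrepr := repr_coord (E := E) b hb0 hb1
  refine ⟨{ toFun := fun ξ => algebraMap ℚ E (b.repr ξ 0) + algebraMap ℚ E (-(b.repr ξ 1)) * θ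
            map_one' := ?_
            map_mul' := fun ξ η => ?_
            map_zero' := by simp
            map_add' := fun ξ η => by simp only [map_add, Finsupp.add_apply, neg_add, map_neg]; ring },
          fun u v => ?_⟩
  · have h := hrepr 1 0
    simp only [map_one, map_zero, zero_mul, add_zero] at h
    simp [h.1, h.2]
  · -- write `ξ = u + vθ`, `η = p + qθ`
    set u := b.repr ξ 0; set v := b.repr ξ 1; set p := b.repr η 0; set q := b.repr η 1
    have hξ := eq_coord_add_coord_mul b hb0 hb1 ξ
    have hη := eq_coord_add_coord_mul b hb0 hb1 η
    have hprod : ξ * η = algebraMap ℚ E (u * p + d * v * q) + algebraMap ℚ E (u * q + v * p) * θ := by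
      rw [hξ, hη, coord_mul_coord hθ]
    rw [hprod, (hrepr _ _).1, (hrepr _ _).2, coord_mul_coord hθ]
    simp only [map_add, map_mul, map_neg]
    ring
  · change algebraMap ℚ E (b.repr _ 0) + algebraMap ℚ E (-(b.repr _ 1)) * θ = _
    rw [(hrepr u v).1, (hrepr u v).2]

end Coordinates

end Literature.NumberTheory.QuadraticForms
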